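import Literature.NumberTheory.EllipticCurves.RingClassFieldGenusProofs
import Literature.NumberTheory.QuadraticFields.RingClassGenusCharacterTriviality
import Literature.NumberTheory.GaloisRepresentations.KummerCubicCharacterConductor
import Literature.NumberTheory.EllipticCurves.JZeroKolyvaginPrimes
import Literature.NumberTheory.EllipticCurves.KummerCubeRoots
import HarnessLib

/-!
# Cube roots of integers in ring class fields of `K = ℚ(ω)`: `∛D ∈ K[f]` for `9D₀ ∣ f`
# (Hu–Shu–Yin Prop. 2.4: `K(∛3) = H_9`, `K(∛p) ⊆ H_{3p}`, `K(∛3, ∛p) ⊆ H_{9p}`; Cox §9.A)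

Topic `NumberTheory/EllipticCurves` (next to `RingClassFieldGenusProofs.lean`, whose genus theorem
`sqrt_intCast_mem_ringClassField` — `√d ∈ K[f]` — this file continues with CUBE roots); namespace
`Literature.NumberTheory.EllipticCurves`. THEOREMS only (no definition, no named fact, no instance;
D-0026), all unconditional, on the tree's PROVED class field theory of `K[f]`
(`exists_classField_algEquiv_ringClassField`, Cox Thm. 11.1) and of the cubic Kummer extension
`K(∛D)/K` (`KummerCubicCharacterPeriodicity`, `KummerCubicCharacterConductor`).

For `K = ℚ(ω)` (route binders `ω² + ω + 1 = 0`, `[K : ℚ] = 2`), `ι : K → ℂ` and natural numbers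
`D`, `D₀`, `f ≠ 0`, `k` with `3D ∣ 9D₀`, `3D ∣ (3D₀)^k` and `9D₀ ∣ f`:

* `mem_ringClassField_of_pow_three_eq` — cube roots of `z³`, `z ∈ K[f]`, lie in `K[f]` (`ω ∈ K`);
* **`cubeRoot_natCast_mem_ringClassField`** — every complex `r` with `r³ = D` lies in
  `ringClassField K ι f`.  Proof = the architecture of `sqrt_intCast_mem_ringClassField`: a
  degree-one prime `v ∤ f` split in the class field `R_f ≅ K[f]` is `(α)` with `α ≡ n (mod f)`, `n ∈ ℤ`
  prime to `f` (`RingClass.exists_generator_of_primeClass_eq_one`); sharp periodicity mod `9D₀`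
  (`artinSymbol_kummerChar_eq_of_sub_mem_span_of_le`) and the rational-integer lemma
  (`artinSymbol_kummerChar_span_intCast_eq_one`) give `kummerChar(Frob_v) = 1`, so `v` splits in
  `K(∛D)` (`mem_splitPrimes_kummerField_of_kummerChar_eq_one`); Bauer
  (`le_of_splitPrimes_subset_of_prime_absNorm_algClosure`) gives `K(∛D) ⊆ R_f`, and the other two
  cube roots differ by `ι(ω)^{±1}`;
* corollaries `cubeRoot_three_mem_ringClassField` (`∛3 ∈ K[9n]`), `cubeRoot_mem_ringClassField_nine_mul`
  (`∛p ∈ K[9pn]`), `cubeRoot_three_mul_mem_ringClassField` (`∛(3p) ∈ K[9pn]`) — `p, n ≥ 1`, no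
  congruence hypothesis on `p`.

HONEST FRAMING: classical class field theory over `ℚ(ω)` (Hu–Shu–Yin prove Prop. 2.4 by Shimura
reciprocity and cubic Hilbert symbols; here: Artin reciprocity for `K(∛D)/K` as proved in the tree).
Nothing here refers to elliptic curves or claims any summit statement.

## References

* Y. Hu, J. Shu, H. Yin, *An explicit Gross–Zagier formula related to the Sylvester conjecture*,
  Trans. AMS 372 (2019), §2 Prop. 2.4 (1) and the field diagram following it (arXiv:1708.05266 p. 7:
  `H_{9p} = H_{3p}(∛3)`, `L_{(3)} = K(∛3) = H_9`, `L_{(p)} = K(∛p) ⊂ H_{3p}`, `L_{(3,p)} ⊂ H_{9p}`).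
  [HuShuYin2019]
* D. A. Cox, *Primes of the form x² + ny²*, 2nd ed. (2013), §9.A Thm. 9.2, Prop. 9.5, Thm. 9.9 (the
  ring class field `K(∛2)` of conductor `6` and `(2/·)₃`), Thm. 9.18 with (9.20)–(9.23) (PDF pp.
  200, 204–206), §11.A Thm. 11.1. [Cox2013]
* J. Neukirch, *Algebraic Number Theory* (1999), Ch. VII (13.9)–(13.10) (Bauer). [NeukirchANT1999]

## Mathlib / tree search

Tree: `exists_classField_algEquiv_ringClassField`, `le_of_splitPrimes_subset_of_prime_absNorm_algClosure`,
`sqrt_intCast_mem_ringClassField` (the quadratic model), `RingClass.exists_generator_of_primeClass_eq_one`,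
`apply_mem_ringClassField`, `kummerField`, `cubeRoot`, `cubeRootL_pow_three`, `isGalois_kummerField`,
`exists_isPrimitiveRoot_three`, `JZero.isCyclotomicExtension_three_of_sq_add_self_add_one`,
`JZero.isImaginaryQuadratic_of_sq_add_self_add_one`, `JZero.exists_aut_apply_eq_sq`,
`Kummer.exists_eq_pow_mul_of_pow_three_eq`. Mathlib: `Nat.cast_dvd_cast`, `Ideal.span_singleton_le_span_singleton`.
`lean search 'cubeRoot.*ringClassField|pow_three.*mem_ringClassField'`: no prior hits.
-/

noncomputable section

open NumberField IsDedekindDomain IsDedekindDomain.HeightOneSpectrum Filter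
open scoped nonZeroDivisors IntermediateField Classical

namespace Literature.NumberTheory.EllipticCurves

open Literature.NumberTheory.GaloisRepresentations Literature.NumberTheory.NumberFields
open Literature.NumberTheory.QuadraticFields.RingClass
open Literature.NumberTheory.LFunctions.AbelianDensity

variable {K : Type} [Field K] [NumberField K]

/-! ### `∛D ∈ K[f]` -/

/-- All complex cube roots of a cube `z³` with `z ∈ K[f]` lie in `K[f]` (they are `ι(ω)^i z`,
`ω ∈ K`). [cite: Cox2013, §9.A (K ⊆ K[f])] -/
theorem mem_ringClassField_of_pow_three_eq {ω : K} (hω : ω ^ 2 + ω + 1 = 0)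
    (h2 : Module.finrank ℚ K = 2) (ι : K →+* ℂ) (f : ℕ) {z r : ℂ}
    (hz : z ∈ ringClassField K ι f) (h : r ^ 3 = z ^ 3) : r ∈ ringClassField K ι f := by
  by_cases hz0 : z = 0
  · rw [hz0] at h
    have hr : r = 0 := pow_eq_zero_iff (n := 3) (by norm_num) |>.mp (by simpa using h)
    rw [hr]
    exact zero_mem _
  have hζ : IsPrimitiveRoot (ι ω) 3 :=
    ((JZero.exists_aut_apply_eq_sq K hω h2).1).map_of_injective ι.injective
  obtain ⟨i, -, hi⟩ := Kummer.exists_eq_pow_mul_of_pow_three_eq hζ hz0 h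
  rw [hi]
  exact mul_mem (pow_mem (apply_mem_ringClassField ι f ω) i) hz

/-- **`∛D ∈ K[f]`** for `K = ℚ(ω)`: let `D`, `D₀`, `f ≠ 0`, `k` be natural numbers with
`3D ∣ 9D₀`, `3D ∣ (3D₀)^k` and `9D₀ ∣ f`. Then every `r ∈ ℂ` with `r³ = D` lies in the ring class
field `K[f] = ringClassField K ι f`. (Instances: `∛3 ∈ K[9] = H_9`, `∛p ∈ K[9p]`, `∛(3p) ∈ K[9p]`;
Hu–Shu–Yin Prop. 2.4 (1) and the field diagram after it; Cox Prop. 9.5/Thm. 9.9 for the analogous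
`K(∛2) = K[6]`.) PROOF: the class field `R_f ≅ K[f]` (`exists_classField_algEquiv_ringClassField`);
a degree-one prime `v ∤ f` split in `R_f` is `(α)`, `α ≡ n (mod f)`, `n ∈ ℤ` prime to `f`
(`RingClass.exists_generator_of_primeClass_eq_one`); periodicity mod `9D₀` and the rational-integer
lemma give `kummerChar(Frob_v) = 1`, so `v` splits in `K(∛D)`; Bauer gives `K(∛D) ⊆ R_f`.
[cite: HuShuYin2019, §2 Prop. 2.4 (1) and field diagram (arXiv p. 7)] [cite: Cox2013, §9.A Prop. 9.5, Thm. 9.9, Thm. 9.18; §11.A Thm. 11.1] -/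
theorem cubeRoot_natCast_mem_ringClassField {ω : K} (hω : ω ^ 2 + ω + 1 = 0)
    (h2 : Module.finrank ℚ K = 2) (ι : K →+* ℂ) {D D₀ f k : ℕ} (hf : f ≠ 0)
    (h9 : 3 * D ∣ 9 * D₀) (hk : 3 * D ∣ (3 * D₀) ^ k) (hD₀f : 9 * D₀ ∣ f)
    (r : ℂ) (hr : r ^ 3 = (D : ℂ)) : r ∈ ringClassField K ι f := by
  have hK : IsImaginaryQuadratic K := JZero.isImaginaryQuadratic_of_sq_add_self_add_one hω h2
  haveI := JZero.isCyclotomicExtension_three_of_sq_add_self_add_one hω h2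
  obtain ⟨ζ, hζ⟩ := exists_isPrimitiveRoot_three (K := K)
  -- it suffices to find ONE cube root of `D` in `K[f]`
  suffices hz : ∃ z : ℂ, z ∈ ringClassField K ι f ∧ z ^ 3 = (D : ℂ) by
    obtain ⟨z, hz, hz3⟩ := hz
    exact mem_ringClassField_of_pow_three_eq hω h2 ι f hz (hr.trans hz3.symm)
  rcases em (∃ b : K, b ^ 3 = ((D : 𝓞 K) : K)) with ⟨b, hb⟩ | hcube'
  · refine ⟨ι b, apply_mem_ringClassField ι f b, ?_⟩
    rw [← map_pow, hb]
    simp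
  have hcube : ∀ b : K, b ^ 3 ≠ ((D : 𝓞 K) : K) := fun b hb ↦ hcube' ⟨b, hb⟩
  haveI := isGalois_kummerField hζ hcube
  obtain ⟨R, hfd, hgal, -, hsplit, ⟨eR⟩⟩ := exists_classField_algEquiv_ringClassField hK ι hf
  haveI := hfd
  haveI := hgal
  have h3Df : 3 * D ∣ f := h9.trans hD₀f
  -- Bauer: `K(∛D) ≤ R`, testing on degree-one primes `v ∤ f` that split completely in `R`
  have hLR : kummerField (D : 𝓞 K) ≤ R := by
    refine le_of_splitPrimes_subset_of_prime_absNorm_algClosure ?_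
    have h𝔪 : Ideal.span {((f : ℕ) : 𝓞 K)} ≠ ⊥ := by
      rw [Ne, Ideal.span_singleton_eq_bot]; exact_mod_cast hf
    have hev : ∀ᶠ v : HeightOneSpectrum (𝓞 K) in cofinite,
        ¬ Ideal.span {((f : ℕ) : 𝓞 K)} ≤ v.asIdeal := by
      rw [Filter.eventually_cofinite]
      simpa using finite_setOf_le_asIdeal h𝔪
    refine hev.mono fun v hvf _ hvR ↦ ?_
    have hmem_of_dvd : ∀ m : ℕ, m ∣ f → ((m : ℕ) : 𝓞 K) ∈ v.asIdeal →
        Ideal.span {((f : ℕ) : 𝓞 K)} ≤ v.asIdeal := fun m hm hmv ↦ by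
      rw [Ideal.span_singleton_le_iff_mem]
      obtain ⟨l, hl⟩ := hm
      rw [hl, Nat.cast_mul]
      exact Ideal.mul_mem_right _ _ hmv
    have hDv : (D : 𝓞 K) ∉ v.asIdeal := fun h ↦
      hvf (hmem_of_dvd D ((Dvd.intro_left 3 rfl).trans h3Df) h)
    have h3v : (3 : 𝓞 K) ∉ v.asIdeal := fun h ↦
      hvf (hmem_of_dvd 3 ((Dvd.intro D rfl).trans h3Df) (by exact_mod_cast h))
    -- `[𝔭_v] = 1`: `v = (α)`, `α ≡ n (mod f)`, `n ∈ ℤ` prime to `f`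
    have h1 := (hsplit v hvf).mp hvR
    obtain ⟨α, n, hn, hva, hαn⟩ := exists_generator_of_primeClass_eq_one f hvf h1
    have hα0 : α ≠ 0 := by
      intro h
      apply v.ne_bot
      rw [hva, h, Ideal.span_singleton_eq_bot]
    have hn3D : IsCoprime n (3 * D : ℤ) :=
      hn.of_isCoprime_of_dvd_right (by exact_mod_cast h3Df)
    have hn0 : (n : 𝓞 K) ≠ 0 := by
      have hn0' : n ≠ 0 := by
        rintro rfl
        have hu : IsUnit (3 * (D : ℤ)) := isCoprime_zero_left.mp hn3D
        rw [Int.isUnit_iff] at hu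
        omega
      exact_mod_cast hn0'
    have hcop : IsCoprime (Ideal.span {(n : 𝓞 K)}) (Ideal.span {3 * (D : 𝓞 K)}) := by
      rw [Ideal.isCoprime_span_singleton_iff]
      simpa using hn3D.map (Int.castRingHom (𝓞 K))
    have hk' : (3 * (D₀ : 𝓞 K)) ^ k ∈ Ideal.span {3 * (D : 𝓞 K)} := by
      obtain ⟨u, hu⟩ := hk
      refine Ideal.mem_span_singleton'.mpr ⟨(u : 𝓞 K), ?_⟩
      have h := congrArg (Nat.cast : ℕ → 𝓞 K) hu
      push_cast at h ⊢
      linear_combination -h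
    have h9' : Ideal.span {9 * (D₀ : 𝓞 K)} ≤ Ideal.span {3 * (D : 𝓞 K)} := by
      rw [Ideal.span_singleton_le_span_singleton]
      have h := Nat.cast_dvd_cast (α := 𝓞 K) h9
      push_cast at h
      exact h
    have hbc : α - (n : 𝓞 K) ∈ Ideal.span {9 * (D₀ : 𝓞 K)} := by
      refine (Ideal.span_singleton_le_span_singleton.mpr ?_) hαn
      have h := Nat.cast_dvd_cast (α := 𝓞 K) hD₀f
      push_cast at h
      exact h
    have hsymα : artinSymbol (fun w ↦ kummerChar hζ hcube ι (galFrob K (kummerField (D : 𝓞 K)) w))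
        (Ideal.span {α}) = 1 := by
      rw [artinSymbol_kummerChar_eq_of_sub_mem_span_of_le hζ hcube ι hk' h9' hα0 hn0 hcop hbc]
      exact artinSymbol_kummerChar_span_intCast_eq_one hζ hcube ι hn3D
    have hFv : kummerChar hζ hcube ι (galFrob K (kummerField (D : 𝓞 K)) v) = 1 := by
      rw [← artinSymbol_asIdeal
        (fun w ↦ kummerChar hζ hcube ι (galFrob K (kummerField (D : 𝓞 K)) w)) v, hva]
      exact hsymα
    exact mem_splitPrimes_kummerField_of_kummerChar_eq_one hζ hcube ι hDv h3v hFv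
  -- transport `∛D ∈ K(∛D) ≤ R ≅ K[f] ⊂ ℂ`
  set sR : R := ⟨cubeRoot (D : 𝓞 K), hLR (cubeRootL (D : 𝓞 K)).2⟩ with hsR
  have hsR3 : sR ^ 3 = algebraMap K R ((D : 𝓞 K) : K) := by
    apply Subtype.ext
    have h := congrArg (fun x : kummerField (D : 𝓞 K) ↦ (x : AlgebraicClosure K))
      (cubeRootL_pow_three (D : 𝓞 K))
    rw [SubmonoidClass.coe_pow, IntermediateField.coe_algebraMap_apply] at h
    rw [SubmonoidClass.coe_pow, IntermediateField.coe_algebraMap_apply]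
    exact h
  refine ⟨((eR sR : ringClassField K ι f) : ℂ), (eR sR).2, ?_⟩
  have h3 : (eR sR) ^ 3 = algebraMap K (ringClassField K ι f) ((D : 𝓞 K) : K) := by
    rw [← map_pow, hsR3, AlgEquiv.commutes]
  have h4 := congrArg (fun x : ringClassField K ι f ↦ (x : ℂ)) h3
  simp only [SubmonoidClass.coe_pow, map_natCast] at h4
  rw [h4]
  simp

/-- **`∛3 ∈ K[9n] ⊇ H_9 = K(∛3)`** (`n ≥ 1`; Hu–Shu–Yin: `L_{(3)} = K(∛3) = H_9`).
[cite: HuShuYin2019, §2 Prop. 2.4 (1) and field diagram (arXiv p. 7)] -/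
theorem cubeRoot_three_mem_ringClassField {ω : K} (hω : ω ^ 2 + ω + 1 = 0)
    (h2 : Module.finrank ℚ K = 2) (ι : K →+* ℂ) {n : ℕ} (hn : n ≠ 0) (r : ℂ) (hr : r ^ 3 = 3) :
    r ∈ ringClassField K ι (9 * n) :=
  cubeRoot_natCast_mem_ringClassField hω h2 ι (D := 3) (D₀ := 1) (k := 2) (by positivity)
    (by norm_num) (by norm_num) ⟨n, by ring⟩ r (by exact_mod_cast hr)

/-- **`∛p ∈ K[9pn] ⊇ H_{3p} ⊇ K(∛p)`** (`p, n ≥ 1`; no congruence condition on `p` is needed).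
[cite: HuShuYin2019, §2 Prop. 2.4 and field diagram (arXiv p. 7: L_{(p)} = K(∛p) ⊂ H_{3p})] -/
theorem cubeRoot_mem_ringClassField_nine_mul {ω : K} (hω : ω ^ 2 + ω + 1 = 0)
    (h2 : Module.finrank ℚ K = 2) (ι : K →+* ℂ) {p n : ℕ} (hp : p ≠ 0) (hn : n ≠ 0) (r : ℂ)
    (hr : r ^ 3 = (p : ℂ)) : r ∈ ringClassField K ι (9 * p * n) :=
  cubeRoot_natCast_mem_ringClassField hω h2 ι (D := p) (D₀ := p) (k := 1) (by positivity)
    ⟨3, by ring⟩ ⟨1, by ring⟩ ⟨n, by ring⟩ r hr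

/-- **`∛(3p) ∈ K[9pn] ⊇ H_{9p} ⊇ L_{(3p)} = K(∛(3p))`** (`p, n ≥ 1`) — the radical generating
Hu–Shu–Yin's character `χ(σ) = (∛(3p))^{σ−1}`; in particular `v = ∛(p/9) = ∛(3p)/3` and
`∛(p²/3) = (∛(3p))²/3` lie in `K[9pn]`.
[cite: HuShuYin2019, §1 p. 4 (χ) and §2 Prop. 2.4, field diagram (arXiv p. 7: L_{(3p)} ⊂ H_{9p})] -/
theorem cubeRoot_three_mul_mem_ringClassField {ω : K} (hω : ω ^ 2 + ω + 1 = 0)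
    (h2 : Module.finrank ℚ K = 2) (ι : K →+* ℂ) {p n : ℕ} (hp : p ≠ 0) (hn : n ≠ 0) (r : ℂ)
    (hr : r ^ 3 = 3 * (p : ℂ)) : r ∈ ringClassField K ι (9 * p * n) :=
  cubeRoot_natCast_mem_ringClassField hω h2 ι (D := 3 * p) (D₀ := p) (k := 2) (by positivity)
    ⟨1, by ring⟩ ⟨p, by ring⟩ ⟨n, by ring⟩ r (by push_cast; exact hr)

end Literature.NumberTheory.EllipticCurves

end
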